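import Mathlib
import HarnessLib
import Summits.Ventures.LatticeQCDFlow.Exactness.NCMCGeneralSpaceReplicaVectorCLT
import Summits.Ventures.LatticeQCDFlow.Exactness.NCMCGeneralSpaceReplicaTStatisticCoverage

/-!
# `R ≥ 2` INDEPENDENT runs, each with a CLT of the same variance: the "independent runs" `t`-interval has the universal limiting coverage `L_R(q)`

HONEST FRAMING: exact (Metropolis-corrected) sampling algorithms for lattice gauge theory;
figures of merit are autocorrelation/cost numbers at stated couplings and volumes; no
continuum-physics claim.

Venture `LatticeQCDFlow` (cell pub-lqcd), topic `Exactness`; FANOUT row 13 (`eng-snf`, GEN-23, replica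
pooling).  NEW WORK of the cell (composition of `NCMCGeneralSpaceReplicaVectorCLT` — independent
coordinates with Gaussian limits converge jointly — with `NCMCGeneralSpaceReplicaTStatistic` /
`NCMCGeneralSpaceReplicaTStatisticCoverage` — a.e.-continuous mapping, atomless limit law, scale
invariance); not a published result; no definition is introduced; nothing is cited as a fact
(Student's `t_{R−1}` is NAMED ONLY).

WHY (row 13, and rows 8 / 9 / 16 modelling replicas as independent processes).  The most common error
bar in practice for `R` independent runs of ANY consistent, asymptotically normal estimator
`θ̂_{r,n}` (`√n (θ̂_{r,n} − θ) ⇒ N(0, v)`, the same `v > 0` for every run — e.g. `R` independent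
restart/NCMC chains, but also `R` independent SNF-weighted batches) is the "independent runs" bar:
`θ̄̂_n ± q · √(Σ_r (θ̂_{r,n} − θ̄̂_n)² / (R(R−1)))`.  Typed here, on the product of the runs' own
probability spaces: its coverage converges to `L_R(q) = N(0,1)^{⊗R}{z | |z̄/√(Σ_r (z_r − z̄)²/(R(R−1)))| ≤ q}`
— the same number for every estimator and every `v` — so it is calibrated iff `q` is chosen with
`L_R(q) = 1 − α`.  Nothing about the runs is used beyond independence and the marginal CLTs.

## Content
* **`tendstoInDistribution_tStat_of_indep`** — `X_{r,n} ⇒ N(0, v)` for each `r`, independent across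
  `r` (product law), `v ≠ 0`, `R ≥ 2` ⇒ `t((X_{r,n})_r) ⇒ t(Z)`, `Z ~ N(0, v)^{⊗R}`.
* **`tendsto_measure_abs_tStat_le_of_indep`** — `P(|t((X_{r,n})_r)| ≤ q) → L_R(q)`, every `q ≥ 0`.
* **`tendsto_measure_abs_studentised_le_of_indep`** — the estimator form: `√n (θ̂_{r,n} − θ) ⇒ N(0, v)`
  for each `r` ⇒ `P(|(θ̄̂_n − θ)/√(Σ_r (θ̂_{r,n} − θ̄̂_n)²/(R(R−1)))| ≤ q) → L_R(q)`.

NOT CLAIMED: the value of `L_R(q)` (Student's `t_{R−1}`); unequal variances across runs (then the limit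
is NOT `L_R(q)`); dependent runs; anything numerical.
-/

namespace Summit.Ventures.LatticeQCDFlow.Exactness.GeneralNCMC

open MeasureTheory ProbabilityTheory Filter Finset WithLp
open scoped ENNReal NNReal Topology

section Indep

variable {ι : Type*} [Fintype ι] [Nontrivial ι] {Ω : ι → Type*} [∀ r, MeasurableSpace (Ω r)]
  {P : (r : ι) → Measure (Ω r)} [∀ r, IsProbabilityMeasure (P r)]

/-- **`t` OF `R ≥ 2` INDEPENDENT ASYMPTOTICALLY `N(0, v)` COORDINATES CONVERGES TO `t(Z)`.** -/
theorem tendstoInDistribution_tStat_of_indep {X : (r : ι) → ℕ → Ω r → ℝ}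
    (hX : ∀ r n, Measurable (X r n)) {v : ℝ≥0} (hv : v ≠ 0)
    (h : ∀ r, TendstoInDistribution (X r) atTop id (fun _ => P r) (gaussianReal 0 v)) :
    TendstoInDistribution
      (fun (n : ℕ) (ω : (r : ι) → Ω r) => (∑ r, X r n (ω r)) / Fintype.card ι
        / Real.sqrt ((∑ r, (X r n (ω r) - (∑ r', X r' n (ω r')) / Fintype.card ι) ^ 2)
            / ((Fintype.card ι : ℝ) * (Fintype.card ι - 1))))
      atTop
      (fun z : ι → ℝ => (∑ r, z r) / Fintype.card ι
        / Real.sqrt ((∑ r, (z r - (∑ r', z r') / Fintype.card ι) ^ 2)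
            / ((Fintype.card ι : ℝ) * (Fintype.card ι - 1))))
      (fun _ => Measure.pi P) (Measure.pi fun _ : ι => gaussianReal 0 v) :=
  tendstoInDistribution_tStat_of_pi_gaussianReal' hv (tendstoInDistribution_pi_toLp hX h)

/-- **THE "INDEPENDENT RUNS" `t`-INTERVAL HAS THE UNIVERSAL LIMITING COVERAGE `L_R(q)`**:
`P(|t((X_{r,n})_r)| ≤ q) → N(0,1)^{⊗R}{|t| ≤ q}` for every `q ≥ 0`. -/
theorem tendsto_measure_abs_tStat_le_of_indep {X : (r : ι) → ℕ → Ω r → ℝ}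
    (hX : ∀ r n, Measurable (X r n)) {v : ℝ≥0} (hv : v ≠ 0)
    (h : ∀ r, TendstoInDistribution (X r) atTop id (fun _ => P r) (gaussianReal 0 v))
    {q : ℝ} (hq : 0 ≤ q) :
    Tendsto (fun n : ℕ => Measure.pi P {ω : (r : ι) → Ω r | |(∑ r, X r n (ω r)) / Fintype.card ι
        / Real.sqrt ((∑ r, (X r n (ω r) - (∑ r', X r' n (ω r')) / Fintype.card ι) ^ 2)
            / ((Fintype.card ι : ℝ) * (Fintype.card ι - 1)))| ≤ q}) atTop
      (𝓝 ((Measure.pi fun _ : ι => gaussianReal 0 1) {z : ι → ℝ | |(∑ r, z r) / Fintype.card ι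
        / Real.sqrt ((∑ r, (z r - (∑ r', z r') / Fintype.card ι) ^ 2)
            / ((Fintype.card ι : ℝ) * (Fintype.card ι - 1)))| ≤ q})) := by
  have h1 := tendsto_measure_abs_tStat_le_of_pi_gaussianReal hv (tendstoInDistribution_pi_toLp hX h) hq
  rw [pi_gaussianReal_measure_abs_tStat_le_eq hv] at h1
  exact h1

/-- **THE ESTIMATOR FORM.**  `R ≥ 2` independent runs of an estimator with `√n (θ̂_{r,n} − θ) ⇒ N(0, v)`
(`v ≠ 0`) for every run: the coverage of `θ̄̂_n ± q √(Σ_r (θ̂_{r,n} − θ̄̂_n)²/(R(R−1)))` converges to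
`L_R(q)` for every `q ≥ 0`. -/
theorem tendsto_measure_abs_studentised_le_of_indep {θhat : (r : ι) → ℕ → Ω r → ℝ}
    (hθ : ∀ r n, Measurable (θhat r n)) (θ : ℝ) {v : ℝ≥0} (hv : v ≠ 0)
    (h : ∀ r, TendstoInDistribution (fun (n : ℕ) ω => Real.sqrt (n : ℝ) * (θhat r n ω - θ)) atTop id
      (fun _ => P r) (gaussianReal 0 v))
    {q : ℝ} (hq : 0 ≤ q) :
    Tendsto (fun n : ℕ => Measure.pi P {ω : (r : ι) → Ω r |
        |((∑ r, θhat r n (ω r)) / Fintype.card ι - θ)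
          / Real.sqrt ((∑ r, (θhat r n (ω r) - (∑ r', θhat r' n (ω r')) / Fintype.card ι) ^ 2)
            / ((Fintype.card ι : ℝ) * (Fintype.card ι - 1)))| ≤ q}) atTop
      (𝓝 ((Measure.pi fun _ : ι => gaussianReal 0 1) {z : ι → ℝ | |(∑ r, z r) / Fintype.card ι
        / Real.sqrt ((∑ r, (z r - (∑ r', z r') / Fintype.card ι) ^ 2)
            / ((Fintype.card ι : ℝ) * (Fintype.card ι - 1)))| ≤ q})) := by
  have h1 := tendsto_measure_abs_tStat_le_of_indep
    (X := fun r (n : ℕ) ω => Real.sqrt (n : ℝ) * (θhat r n ω - θ))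
    (fun r n => measurable_const.mul ((hθ r n).sub measurable_const)) hv h hq
  -- for `n ≥ 1` the two events coincide (scale invariance + `tStat_sub_const`); `n = 0` is irrelevant
  refine h1.congr' ?_
  filter_upwards [eventually_gt_atTop 0] with n hn
  have hc : 0 < Real.sqrt (n : ℝ) := Real.sqrt_pos.2 (by exact_mod_cast hn)
  congr 1
  ext ω
  simp only [Set.mem_setOf_eq]
  rw [tStat_mul_left (fun r => θhat r n (ω r) - θ) hc, tStat_sub_const (fun r => θhat r n (ω r)) θ]

end Indep

end Summit.Ventures.LatticeQCDFlow.Exactness.GeneralNCMC
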